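import Literature.AlgebraicGeometry.HodgeTheory.FermatShiodaCondition
import HarnessLib

/-!
# Fermat-quotient characters of the (3,3) cyclic sphere habitats of ℚ(√−3)-Weil SIXFOLDS, m ∈ {6, 12} (WEIL-2 gen 31, fact-free core)

research route, not a corollary; conditional on HC_CM plus one named minimal statement.

Cell `pub-hodge-ring2-ab-*` (ALL ABELIAN VARIETIES), seat WEIL-2 gen 31, account
`run/shared/lean/pub/pub-hodge-ring2/pub-hodge-ring2-ab-weil-2/FERMAT-G31.md` (§2 THEOREM F, §5 tables).

Informal setting (not formalised; the geometry has no carriers here).  THEOREM F of the account: for a cyclic cover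
`C : y^m = ∏_{j=1}^{h+2} (x - b_j)^{α_j}` of `ℙ¹` (every `b_j` a branch point, `Σ α_j ≡ 0 mod m`), Schoen's quotient
`W₀ = G̃∖C^h` of the `h`-fold self-product [Schoen 1988, §1–2] is isomorphic, `μ_m`-equivariantly over `S^hℙ¹ = ℙ^h`, to
the quotient `X^h_m / G_α` of the FERMAT hypersurface of degree `m` and dimension `h` by `G_α = ker(α : μ_m^{h+2}/μ_m → μ_m)`:
the `h + 2` incidence hyperplanes `{D ∋ b_j} ⊂ ℙ^h` form a projective frame, so `(ℙ^h, ∪_j {D ∋ b_j})` is projectively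
equivalent to `(Σ_j w_j = 0) ⊂ ℙ^{h+1}` with its coordinate hyperplanes, whatever the `b_j`.  Consequently Schoen's Hodge
structure `U ⊂ H^h(C^h, ℚ)` has `U ⊗ ℂ ≅ ⊕_{t ∈ (ℤ/m)ˣ} V(tα)` (Shioda's eigenlines); `U` has type `(h/2, h/2)` iff the
multiset `{α}` is a Hodge multiset (`FermatCharacter.IsHodgeMultiset` = Shioda's `𝔅` = Schoen's Cor. 1.9); and `U` — hence,
by the proof of [Schoen 1988, Cor. 3.1], Weil's Hodge structure on the `μ_m`-primitive Prym of `C` — is generated by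
algebraic cycles as soon as the `tα` are cycle characters of `X^h_m`.  The theorems below certify, for exponent types met in
the cell (sphere presentations closing OPEN rows of EIGENPRYM-G10's THEOREM P; non-simple sphere types of the cyclic atlas),
(i) the Hodge condition and (ii) membership in EVERY `IsShiodaClosed` family (`FermatShiodaCondition`) through an explicit
decomposition into pairs, Lefschetz 4-sets and semi-decomposable 6-sets — so that only [Shioda 1979, Thm I, Thm II c),
§4 Lemma 1] and Lefschetz (1,1) are invoked, not the condition `(P_m)`.  Multisets carry representatives in `[1, m-1]`;
`[a^k …]` lists multiplicities; witnesses are written `(pair + (surface + …))`.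
This file: the two rewriting helpers `star_eq`, `pair_eq`; the NON-SIMPLE sphere types of signature (3,3) (8 branch points,
`X⁶_6`) and the `m = 12` presentations (`X⁶_12`) closing (3,3) rows.
0 sorry, no `def`, no named fact; `HC_CM` does not occur.  All proofs are `decide` on explicit finite data.
-/

open Multiset
open Literature.AlgebraicGeometry.HodgeTheory.FermatCharacter

namespace Summit.HodgeConjecture.Ring2AbelianAll.FermatQuotientCharactersSixfolds

/-- Juxtaposition step of the inductive structure, with the target rewritten along `t + u = s` (Shioda 1979 Thm II c)).
[cite: Shioda1979HodgeFermat, Thm II c)] research route, not a corollary; conditional on HC_CM plus one named minimal statement. -/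
theorem star_eq {m : ℕ} {C : Multiset (ZMod m) → Prop} (hC : IsShiodaClosed C) {t u s : Multiset (ZMod m)}
    (e : t + u = s) (ht0 : t ≠ 0) (hu0 : u ≠ 0) (ht : IsHodgeMultiset t) (hu : IsHodgeMultiset u)
    (hCt : C t) (hCu : C u) : C s :=
  e ▸ hC.star t u ht0 hu0 ht hu hCt hCu

/-- The pair `(a, -a)` (a point of `X⁰_m`), with the target rewritten along `{a, -a} = p`.
[cite: Shioda1979HodgeFermat, (1.10)] research route, not a corollary; conditional on HC_CM plus one named minimal statement. -/
theorem pair_eq {m : ℕ} {C : Multiset (ZMod m) → Prop} (hC : IsShiodaClosed C) {a : ZMod m} {p : Multiset (ZMod m)}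
    (e : ({a, -a} : Multiset (ZMod m)) = p) (ha : a ≠ 0) : C p :=
  e ▸ hC.pair a ha

/-- `[1^1 2^1 3^3 4^3]`, `m = 6`: a Hodge multiset (Shioda's `𝔅^6_6` for `α` and its unit multiples ⟺ Weil type `(3,3)` of the
μ_6-primitive Prym, Schoen Cor. 1.9).  Cyclic-atlas sphere type, (3,3), non-split.  [locator FERMAT-G31 §5]
research route, not a corollary; conditional on HC_CM plus one named minimal statement. -/
theorem isHodgeMultiset_1_2_3_3_3_4_4_4 : IsHodgeMultiset ({1, 2, 3, 3, 3, 4, 4, 4} : Multiset (ZMod 6)) := by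
  unfold IsHodgeMultiset mNormSum; decide

/-- `[1^1 2^1 3^3 4^3]`, `m = 6`: in every `IsShiodaClosed` family via `(pair[2, 4] + (pair[3, 3] + surface[1, 3, 4, 4]))` — with `C = 𝔈_6`:
the eigenlines `V(tα) ⊂ H^6(X^6_6; ℂ)` are algebraic granted Shioda 1979 Thm II c)/§4 Lemma 1 and Lefschetz (1,1) (no `(P_6)`).
[locator FERMAT-G31 §2, §5]  research route, not a corollary; conditional on HC_CM plus one named minimal statement. -/
theorem mem_of_isShiodaClosed_1_2_3_3_3_4_4_4 {C : Multiset (ZMod 6) → Prop} (hC : IsShiodaClosed C) :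
    C ({1, 2, 3, 3, 3, 4, 4, 4} : Multiset (ZMod 6)) :=
  (star_eq hC (t := {2, 4}) (u := {1, 3, 3, 3, 4, 4}) (by decide) (by decide) (by decide)
    (by unfold IsHodgeMultiset mNormSum; decide) (by unfold IsHodgeMultiset mNormSum; decide)
    (pair_eq hC (a := 2) (p := {2, 4}) (by decide) (by decide))
    (star_eq hC (t := {3, 3}) (u := {1, 3, 4, 4}) (by decide) (by decide) (by decide)
      (by unfold IsHodgeMultiset mNormSum; decide) (by unfold IsHodgeMultiset mNormSum; decide)
      (pair_eq hC (a := 3) (p := {3, 3}) (by decide) (by decide))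
      (hC.surface {1, 3, 4, 4} (by unfold IsHodgeMultiset mNormSum; decide) (by decide))))

/-- `[1^1 2^2 3^1 4^4]`, `m = 6`: a Hodge multiset (Shioda's `𝔅^6_6` for `α` and its unit multiples ⟺ Weil type `(3,3)` of the
μ_6-primitive Prym, Schoen Cor. 1.9).  Cyclic-atlas sphere type, (3,3), non-split.  [locator FERMAT-G31 §5]
research route, not a corollary; conditional on HC_CM plus one named minimal statement. -/
theorem isHodgeMultiset_1_2_2_3_4_4_4_4 : IsHodgeMultiset ({1, 2, 2, 3, 4, 4, 4, 4} : Multiset (ZMod 6)) := by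
  unfold IsHodgeMultiset mNormSum; decide

/-- `[1^1 2^2 3^1 4^4]`, `m = 6`: in every `IsShiodaClosed` family via `(pair[2, 4] + semi([1, 2, 3]|[4, 4, 4]))` — with `C = 𝔈_6`:
the eigenlines `V(tα) ⊂ H^6(X^6_6; ℂ)` are algebraic granted Shioda 1979 Thm II c)/§4 Lemma 1 and Lefschetz (1,1) (no `(P_6)`).
[locator FERMAT-G31 §2, §5]  research route, not a corollary; conditional on HC_CM plus one named minimal statement. -/
theorem mem_of_isShiodaClosed_1_2_2_3_4_4_4_4 {C : Multiset (ZMod 6) → Prop} (hC : IsShiodaClosed C) :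
    C ({1, 2, 2, 3, 4, 4, 4, 4} : Multiset (ZMod 6)) :=
  (star_eq hC (t := {2, 4}) (u := {1, 2, 3, 4, 4, 4}) (by decide) (by decide) (by decide)
    (by unfold IsHodgeMultiset mNormSum; decide) (by unfold IsHodgeMultiset mNormSum; decide)
    (pair_eq hC (a := 2) (p := {2, 4}) (by decide) (by decide))
    (hC.semi {1, 2, 3, 4, 4, 4} (by unfold IsHodgeMultiset mNormSum; decide)
      ⟨{1, 2, 3}, {4, 4, 4}, rfl, rfl, by decide, by decide, by decide⟩))

/-- `[1^1 3^5 4^2]`, `m = 6`: a Hodge multiset (Shioda's `𝔅^6_6` for `α` and its unit multiples ⟺ Weil type `(3,3)` of the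
μ_6-primitive Prym, Schoen Cor. 1.9).  Cyclic-atlas sphere type, (3,3), non-split.  [locator FERMAT-G31 §5]
research route, not a corollary; conditional on HC_CM plus one named minimal statement. -/
theorem isHodgeMultiset_1_3_3_3_3_3_4_4 : IsHodgeMultiset ({1, 3, 3, 3, 3, 3, 4, 4} : Multiset (ZMod 6)) := by
  unfold IsHodgeMultiset mNormSum; decide

/-- `[1^1 3^5 4^2]`, `m = 6`: in every `IsShiodaClosed` family via `(pair[3, 3] + (pair[3, 3] + surface[1, 3, 4, 4]))` — with `C = 𝔈_6`:
the eigenlines `V(tα) ⊂ H^6(X^6_6; ℂ)` are algebraic granted Shioda 1979 Thm II c)/§4 Lemma 1 and Lefschetz (1,1) (no `(P_6)`).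
[locator FERMAT-G31 §2, §5]  research route, not a corollary; conditional on HC_CM plus one named minimal statement. -/
theorem mem_of_isShiodaClosed_1_3_3_3_3_3_4_4 {C : Multiset (ZMod 6) → Prop} (hC : IsShiodaClosed C) :
    C ({1, 3, 3, 3, 3, 3, 4, 4} : Multiset (ZMod 6)) :=
  (star_eq hC (t := {3, 3}) (u := {1, 3, 3, 3, 4, 4}) (by decide) (by decide) (by decide)
    (by unfold IsHodgeMultiset mNormSum; decide) (by unfold IsHodgeMultiset mNormSum; decide)
    (pair_eq hC (a := 3) (p := {3, 3}) (by decide) (by decide))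
    (star_eq hC (t := {3, 3}) (u := {1, 3, 4, 4}) (by decide) (by decide) (by decide)
      (by unfold IsHodgeMultiset mNormSum; decide) (by unfold IsHodgeMultiset mNormSum; decide)
      (pair_eq hC (a := 3) (p := {3, 3}) (by decide) (by decide))
      (hC.surface {1, 3, 4, 4} (by unfold IsHodgeMultiset mNormSum; decide) (by decide))))

/-- `[1^2 2^1 3^1 4^3 5^1]`, `m = 6`: a Hodge multiset (Shioda's `𝔅^6_6` for `α` and its unit multiples ⟺ Weil type `(3,3)` of the
μ_6-primitive Prym, Schoen Cor. 1.9).  Cyclic-atlas sphere type, (3,3), non-split; closes OPEN rows x24h6n12_g53, x24h6n24_g53.  [locator FERMAT-G31 §5]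
research route, not a corollary; conditional on HC_CM plus one named minimal statement. -/
theorem isHodgeMultiset_1_1_2_3_4_4_4_5 : IsHodgeMultiset ({1, 1, 2, 3, 4, 4, 4, 5} : Multiset (ZMod 6)) := by
  unfold IsHodgeMultiset mNormSum; decide

/-- `[1^2 2^1 3^1 4^3 5^1]`, `m = 6`: in every `IsShiodaClosed` family via `(pair[1, 5] + semi([1, 2, 3]|[4, 4, 4]))` — with `C = 𝔈_6`:
the eigenlines `V(tα) ⊂ H^6(X^6_6; ℂ)` are algebraic granted Shioda 1979 Thm II c)/§4 Lemma 1 and Lefschetz (1,1) (no `(P_6)`).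
[locator FERMAT-G31 §2, §5]  research route, not a corollary; conditional on HC_CM plus one named minimal statement. -/
theorem mem_of_isShiodaClosed_1_1_2_3_4_4_4_5 {C : Multiset (ZMod 6) → Prop} (hC : IsShiodaClosed C) :
    C ({1, 1, 2, 3, 4, 4, 4, 5} : Multiset (ZMod 6)) :=
  (star_eq hC (t := {1, 5}) (u := {1, 2, 3, 4, 4, 4}) (by decide) (by decide) (by decide)
    (by unfold IsHodgeMultiset mNormSum; decide) (by unfold IsHodgeMultiset mNormSum; decide)
    (pair_eq hC (a := 1) (p := {1, 5}) (by decide) (by decide))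
    (hC.semi {1, 2, 3, 4, 4, 4} (by unfold IsHodgeMultiset mNormSum; decide)
      ⟨{1, 2, 3}, {4, 4, 4}, rfl, rfl, by decide, by decide, by decide⟩))

/-- `[1^2 2^1 4^5]`, `m = 6`: a Hodge multiset (Shioda's `𝔅^6_6` for `α` and its unit multiples ⟺ Weil type `(3,3)` of the
μ_6-primitive Prym, Schoen Cor. 1.9).  Cyclic-atlas sphere type, (3,3), SPLIT.  [locator FERMAT-G31 §5]
research route, not a corollary; conditional on HC_CM plus one named minimal statement. -/
theorem isHodgeMultiset_1_1_2_4_4_4_4_4 : IsHodgeMultiset ({1, 1, 2, 4, 4, 4, 4, 4} : Multiset (ZMod 6)) := by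
  unfold IsHodgeMultiset mNormSum; decide

/-- `[1^2 2^1 4^5]`, `m = 6`: in every `IsShiodaClosed` family via `(pair[2, 4] + semi([1, 1, 4]|[4, 4, 4]))` — with `C = 𝔈_6`:
the eigenlines `V(tα) ⊂ H^6(X^6_6; ℂ)` are algebraic granted Shioda 1979 Thm II c)/§4 Lemma 1 and Lefschetz (1,1) (no `(P_6)`).
[locator FERMAT-G31 §2, §5]  research route, not a corollary; conditional on HC_CM plus one named minimal statement. -/
theorem mem_of_isShiodaClosed_1_1_2_4_4_4_4_4 {C : Multiset (ZMod 6) → Prop} (hC : IsShiodaClosed C) :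
    C ({1, 1, 2, 4, 4, 4, 4, 4} : Multiset (ZMod 6)) :=
  (star_eq hC (t := {2, 4}) (u := {1, 1, 4, 4, 4, 4}) (by decide) (by decide) (by decide)
    (by unfold IsHodgeMultiset mNormSum; decide) (by unfold IsHodgeMultiset mNormSum; decide)
    (pair_eq hC (a := 2) (p := {2, 4}) (by decide) (by decide))
    (hC.semi {1, 1, 4, 4, 4, 4} (by unfold IsHodgeMultiset mNormSum; decide)
      ⟨{1, 1, 4}, {4, 4, 4}, rfl, rfl, by decide, by decide, by decide⟩))

/-- `[1^2 3^2 4^4]`, `m = 6`: a Hodge multiset (Shioda's `𝔅^6_6` for `α` and its unit multiples ⟺ Weil type `(3,3)` of the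
μ_6-primitive Prym, Schoen Cor. 1.9).  Cyclic-atlas sphere type, (3,3), SPLIT.  [locator FERMAT-G31 §5]
research route, not a corollary; conditional on HC_CM plus one named minimal statement. -/
theorem isHodgeMultiset_1_1_3_3_4_4_4_4 : IsHodgeMultiset ({1, 1, 3, 3, 4, 4, 4, 4} : Multiset (ZMod 6)) := by
  unfold IsHodgeMultiset mNormSum; decide

/-- `[1^2 3^2 4^4]`, `m = 6`: in every `IsShiodaClosed` family via `(pair[3, 3] + semi([1, 1, 4]|[4, 4, 4]))` — with `C = 𝔈_6`:
the eigenlines `V(tα) ⊂ H^6(X^6_6; ℂ)` are algebraic granted Shioda 1979 Thm II c)/§4 Lemma 1 and Lefschetz (1,1) (no `(P_6)`).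
[locator FERMAT-G31 §2, §5]  research route, not a corollary; conditional on HC_CM plus one named minimal statement. -/
theorem mem_of_isShiodaClosed_1_1_3_3_4_4_4_4 {C : Multiset (ZMod 6) → Prop} (hC : IsShiodaClosed C) :
    C ({1, 1, 3, 3, 4, 4, 4, 4} : Multiset (ZMod 6)) :=
  (star_eq hC (t := {3, 3}) (u := {1, 1, 4, 4, 4, 4}) (by decide) (by decide) (by decide)
    (by unfold IsHodgeMultiset mNormSum; decide) (by unfold IsHodgeMultiset mNormSum; decide)
    (pair_eq hC (a := 3) (p := {3, 3}) (by decide) (by decide))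
    (hC.semi {1, 1, 4, 4, 4, 4} (by unfold IsHodgeMultiset mNormSum; decide)
      ⟨{1, 1, 4}, {4, 4, 4}, rfl, rfl, by decide, by decide, by decide⟩))

/-- `[1^2 3^3 4^2 5^1]`, `m = 6`: a Hodge multiset (Shioda's `𝔅^6_6` for `α` and its unit multiples ⟺ Weil type `(3,3)` of the
μ_6-primitive Prym, Schoen Cor. 1.9).  Cyclic-atlas sphere type, (3,3), non-split; closes OPEN rows x12k5h6n03_g23, x12k5h6n04_g23, x24h6n13_g51, x24h6n27_g51.  [locator FERMAT-G31 §5]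
research route, not a corollary; conditional on HC_CM plus one named minimal statement. -/
theorem isHodgeMultiset_1_1_3_3_3_4_4_5 : IsHodgeMultiset ({1, 1, 3, 3, 3, 4, 4, 5} : Multiset (ZMod 6)) := by
  unfold IsHodgeMultiset mNormSum; decide

/-- `[1^2 3^3 4^2 5^1]`, `m = 6`: in every `IsShiodaClosed` family via `(pair[1, 5] + (pair[3, 3] + surface[1, 3, 4, 4]))` — with `C = 𝔈_6`:
the eigenlines `V(tα) ⊂ H^6(X^6_6; ℂ)` are algebraic granted Shioda 1979 Thm II c)/§4 Lemma 1 and Lefschetz (1,1) (no `(P_6)`).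
[locator FERMAT-G31 §2, §5]  research route, not a corollary; conditional on HC_CM plus one named minimal statement. -/
theorem mem_of_isShiodaClosed_1_1_3_3_3_4_4_5 {C : Multiset (ZMod 6) → Prop} (hC : IsShiodaClosed C) :
    C ({1, 1, 3, 3, 3, 4, 4, 5} : Multiset (ZMod 6)) :=
  (star_eq hC (t := {1, 5}) (u := {1, 3, 3, 3, 4, 4}) (by decide) (by decide) (by decide)
    (by unfold IsHodgeMultiset mNormSum; decide) (by unfold IsHodgeMultiset mNormSum; decide)
    (pair_eq hC (a := 1) (p := {1, 5}) (by decide) (by decide))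
    (star_eq hC (t := {3, 3}) (u := {1, 3, 4, 4}) (by decide) (by decide) (by decide)
      (by unfold IsHodgeMultiset mNormSum; decide) (by unfold IsHodgeMultiset mNormSum; decide)
      (pair_eq hC (a := 3) (p := {3, 3}) (by decide) (by decide))
      (hC.surface {1, 3, 4, 4} (by unfold IsHodgeMultiset mNormSum; decide) (by decide))))

/-- `[1^3 3^1 4^2 5^2]`, `m = 6`: a Hodge multiset (Shioda's `𝔅^6_6` for `α` and its unit multiples ⟺ Weil type `(3,3)` of the
μ_6-primitive Prym, Schoen Cor. 1.9).  Cyclic-atlas sphere type, (3,3), non-split; closes OPEN rows x24h6n08_g59, x24h6n20_g59.  [locator FERMAT-G31 §5]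
research route, not a corollary; conditional on HC_CM plus one named minimal statement. -/
theorem isHodgeMultiset_1_1_1_3_4_4_5_5 : IsHodgeMultiset ({1, 1, 1, 3, 4, 4, 5, 5} : Multiset (ZMod 6)) := by
  unfold IsHodgeMultiset mNormSum; decide

/-- `[1^3 3^1 4^2 5^2]`, `m = 6`: in every `IsShiodaClosed` family via `(pair[1, 5] + semi([1, 1, 4]|[3, 4, 5]))` — with `C = 𝔈_6`:
the eigenlines `V(tα) ⊂ H^6(X^6_6; ℂ)` are algebraic granted Shioda 1979 Thm II c)/§4 Lemma 1 and Lefschetz (1,1) (no `(P_6)`).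
[locator FERMAT-G31 §2, §5]  research route, not a corollary; conditional on HC_CM plus one named minimal statement. -/
theorem mem_of_isShiodaClosed_1_1_1_3_4_4_5_5 {C : Multiset (ZMod 6) → Prop} (hC : IsShiodaClosed C) :
    C ({1, 1, 1, 3, 4, 4, 5, 5} : Multiset (ZMod 6)) :=
  (star_eq hC (t := {1, 5}) (u := {1, 1, 3, 4, 4, 5}) (by decide) (by decide) (by decide)
    (by unfold IsHodgeMultiset mNormSum; decide) (by unfold IsHodgeMultiset mNormSum; decide)
    (pair_eq hC (a := 1) (p := {1, 5}) (by decide) (by decide))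
    (hC.semi {1, 1, 3, 4, 4, 5} (by unfold IsHodgeMultiset mNormSum; decide)
      ⟨{1, 1, 4}, {3, 4, 5}, rfl, rfl, by decide, by decide, by decide⟩))

/-- `[1^3 4^4 5^1]`, `m = 6`: a Hodge multiset (Shioda's `𝔅^6_6` for `α` and its unit multiples ⟺ Weil type `(3,3)` of the
μ_6-primitive Prym, Schoen Cor. 1.9).  Cyclic-atlas sphere type, (3,3), SPLIT.  [locator FERMAT-G31 §5]
research route, not a corollary; conditional on HC_CM plus one named minimal statement. -/
theorem isHodgeMultiset_1_1_1_4_4_4_4_5 : IsHodgeMultiset ({1, 1, 1, 4, 4, 4, 4, 5} : Multiset (ZMod 6)) := by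
  unfold IsHodgeMultiset mNormSum; decide

/-- `[1^3 4^4 5^1]`, `m = 6`: in every `IsShiodaClosed` family via `(pair[1, 5] + semi([1, 1, 4]|[4, 4, 4]))` — with `C = 𝔈_6`:
the eigenlines `V(tα) ⊂ H^6(X^6_6; ℂ)` are algebraic granted Shioda 1979 Thm II c)/§4 Lemma 1 and Lefschetz (1,1) (no `(P_6)`).
[locator FERMAT-G31 §2, §5]  research route, not a corollary; conditional on HC_CM plus one named minimal statement. -/
theorem mem_of_isShiodaClosed_1_1_1_4_4_4_4_5 {C : Multiset (ZMod 6) → Prop} (hC : IsShiodaClosed C) :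
    C ({1, 1, 1, 4, 4, 4, 4, 5} : Multiset (ZMod 6)) :=
  (star_eq hC (t := {1, 5}) (u := {1, 1, 4, 4, 4, 4}) (by decide) (by decide) (by decide)
    (by unfold IsHodgeMultiset mNormSum; decide) (by unfold IsHodgeMultiset mNormSum; decide)
    (pair_eq hC (a := 1) (p := {1, 5}) (by decide) (by decide))
    (hC.semi {1, 1, 4, 4, 4, 4} (by unfold IsHodgeMultiset mNormSum; decide)
      ⟨{1, 1, 4}, {4, 4, 4}, rfl, rfl, by decide, by decide, by decide⟩))

/-- `[1^2 2^2 3^1 5^3]`, `m = 6`: a Hodge multiset (Shioda's `𝔅^6_6` for `α` and its unit multiples ⟺ Weil type `(3,3)` of the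
μ_6-primitive Prym, Schoen Cor. 1.9).  Base ℙ¹, `m = 6`, (3,3); closes OPEN rows x24h6n16_g59, x24h6n28_g59.  [locator FERMAT-G31 §5]
research route, not a corollary; conditional on HC_CM plus one named minimal statement. -/
theorem isHodgeMultiset_1_1_2_2_3_5_5_5 : IsHodgeMultiset ({1, 1, 2, 2, 3, 5, 5, 5} : Multiset (ZMod 6)) := by
  unfold IsHodgeMultiset mNormSum; decide

/-- `[1^2 2^2 3^1 5^3]`, `m = 6`: in every `IsShiodaClosed` family via `(pair[1, 5] + semi([1, 2, 3]|[2, 5, 5]))` — with `C = 𝔈_6`: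
the eigenlines `V(tα) ⊂ H^6(X^6_6; ℂ)` are algebraic granted Shioda 1979 Thm II c)/§4 Lemma 1 and Lefschetz (1,1) (no `(P_6)`).
[locator FERMAT-G31 §2, §5]  research route, not a corollary; conditional on HC_CM plus one named minimal statement. -/
theorem mem_of_isShiodaClosed_1_1_2_2_3_5_5_5 {C : Multiset (ZMod 6) → Prop} (hC : IsShiodaClosed C) :
    C ({1, 1, 2, 2, 3, 5, 5, 5} : Multiset (ZMod 6)) :=
  (star_eq hC (t := {1, 5}) (u := {1, 2, 2, 3, 5, 5}) (by decide) (by decide) (by decide)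
    (by unfold IsHodgeMultiset mNormSum; decide) (by unfold IsHodgeMultiset mNormSum; decide)
    (pair_eq hC (a := 1) (p := {1, 5}) (by decide) (by decide))
    (hC.semi {1, 2, 2, 3, 5, 5} (by unfold IsHodgeMultiset mNormSum; decide)
      ⟨{1, 2, 3}, {2, 5, 5}, rfl, rfl, by decide, by decide, by decide⟩))

/-- `[1^1 2^3 3^1 4^1 5^2]`, `m = 6`: a Hodge multiset (Shioda's `𝔅^6_6` for `α` and its unit multiples ⟺ Weil type `(3,3)` of the
μ_6-primitive Prym, Schoen Cor. 1.9).  Base ℙ¹, `m = 6`, (3,3); closes OPEN rows x24h6n10_g53, x24h6n21_g53.  [locator FERMAT-G31 §5]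
research route, not a corollary; conditional on HC_CM plus one named minimal statement. -/
theorem isHodgeMultiset_1_2_2_2_3_4_5_5 : IsHodgeMultiset ({1, 2, 2, 2, 3, 4, 5, 5} : Multiset (ZMod 6)) := by
  unfold IsHodgeMultiset mNormSum; decide

/-- `[1^1 2^3 3^1 4^1 5^2]`, `m = 6`: in every `IsShiodaClosed` family via `(pair[1, 5] + semi([2, 2, 2]|[3, 4, 5]))` — with `C = 𝔈_6`:
the eigenlines `V(tα) ⊂ H^6(X^6_6; ℂ)` are algebraic granted Shioda 1979 Thm II c)/§4 Lemma 1 and Lefschetz (1,1) (no `(P_6)`).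
[locator FERMAT-G31 §2, §5]  research route, not a corollary; conditional on HC_CM plus one named minimal statement. -/
theorem mem_of_isShiodaClosed_1_2_2_2_3_4_5_5 {C : Multiset (ZMod 6) → Prop} (hC : IsShiodaClosed C) :
    C ({1, 2, 2, 2, 3, 4, 5, 5} : Multiset (ZMod 6)) :=
  (star_eq hC (t := {1, 5}) (u := {2, 2, 2, 3, 4, 5}) (by decide) (by decide) (by decide)
    (by unfold IsHodgeMultiset mNormSum; decide) (by unfold IsHodgeMultiset mNormSum; decide)
    (pair_eq hC (a := 1) (p := {1, 5}) (by decide) (by decide))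
    (hC.semi {2, 2, 2, 3, 4, 5} (by unfold IsHodgeMultiset mNormSum; decide)
      ⟨{2, 2, 2}, {3, 4, 5}, rfl, rfl, by decide, by decide, by decide⟩))

/-- `[1^1 2^2 3^3 5^2]`, `m = 6`: a Hodge multiset (Shioda's `𝔅^6_6` for `α` and its unit multiples ⟺ Weil type `(3,3)` of the
μ_6-primitive Prym, Schoen Cor. 1.9).  Base ℙ¹, `m = 6`, (3,3); closes OPEN rows x12k5h6n01_g23, x12k5h6n02_g23, x24h6n06_g51, x24h6n19_g51.  [locator FERMAT-G31 §5]
research route, not a corollary; conditional on HC_CM plus one named minimal statement. -/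
theorem isHodgeMultiset_1_2_2_3_3_3_5_5 : IsHodgeMultiset ({1, 2, 2, 3, 3, 3, 5, 5} : Multiset (ZMod 6)) := by
  unfold IsHodgeMultiset mNormSum; decide

/-- `[1^1 2^2 3^3 5^2]`, `m = 6`: in every `IsShiodaClosed` family via `(pair[1, 5] + (pair[3, 3] + surface[2, 2, 3, 5]))` — with `C = 𝔈_6`:
the eigenlines `V(tα) ⊂ H^6(X^6_6; ℂ)` are algebraic granted Shioda 1979 Thm II c)/§4 Lemma 1 and Lefschetz (1,1) (no `(P_6)`).
[locator FERMAT-G31 §2, §5]  research route, not a corollary; conditional on HC_CM plus one named minimal statement. -/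
theorem mem_of_isShiodaClosed_1_2_2_3_3_3_5_5 {C : Multiset (ZMod 6) → Prop} (hC : IsShiodaClosed C) :
    C ({1, 2, 2, 3, 3, 3, 5, 5} : Multiset (ZMod 6)) :=
  (star_eq hC (t := {1, 5}) (u := {2, 2, 3, 3, 3, 5}) (by decide) (by decide) (by decide)
    (by unfold IsHodgeMultiset mNormSum; decide) (by unfold IsHodgeMultiset mNormSum; decide)
    (pair_eq hC (a := 1) (p := {1, 5}) (by decide) (by decide))
    (star_eq hC (t := {3, 3}) (u := {2, 2, 3, 5}) (by decide) (by decide) (by decide)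
      (by unfold IsHodgeMultiset mNormSum; decide) (by unfold IsHodgeMultiset mNormSum; decide)
      (pair_eq hC (a := 3) (p := {3, 3}) (by decide) (by decide))
      (hC.surface {2, 2, 3, 5} (by unfold IsHodgeMultiset mNormSum; decide) (by decide))))

/-- `[1^2 5^1 7^2 8^2 11^1]`, `m = 12`: a Hodge multiset (Shioda's `𝔅^6_12` for `α` and its unit multiples ⟺ Weil type `(3,3)` of the
μ_12-primitive Prym, Schoen Cor. 1.9).  Base ℙ¹, `m = 12`, (3,3); closes OPEN rows x24h6n11_g59, x24h6n23_g59.  [locator FERMAT-G31 §5]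
research route, not a corollary; conditional on HC_CM plus one named minimal statement. -/
theorem isHodgeMultiset_1_1_5_7_7_8_8_11 : IsHodgeMultiset ({1, 1, 5, 7, 7, 8, 8, 11} : Multiset (ZMod 12)) := by
  unfold IsHodgeMultiset mNormSum; decide

/-- `[1^2 5^1 7^2 8^2 11^1]`, `m = 12`: in every `IsShiodaClosed` family via `(pair[1, 11] + (pair[5, 7] + surface[1, 7, 8, 8]))` — with `C = 𝔈_12`:
the eigenlines `V(tα) ⊂ H^6(X^6_12; ℂ)` are algebraic granted Shioda 1979 Thm II c)/§4 Lemma 1 and Lefschetz (1,1) (no `(P_12)`).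
[locator FERMAT-G31 §2, §5]  research route, not a corollary; conditional on HC_CM plus one named minimal statement. -/
theorem mem_of_isShiodaClosed_1_1_5_7_7_8_8_11 {C : Multiset (ZMod 12) → Prop} (hC : IsShiodaClosed C) :
    C ({1, 1, 5, 7, 7, 8, 8, 11} : Multiset (ZMod 12)) :=
  (star_eq hC (t := {1, 11}) (u := {1, 5, 7, 7, 8, 8}) (by decide) (by decide) (by decide)
    (by unfold IsHodgeMultiset mNormSum; decide) (by unfold IsHodgeMultiset mNormSum; decide)
    (pair_eq hC (a := 1) (p := {1, 11}) (by decide) (by decide))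
    (star_eq hC (t := {5, 7}) (u := {1, 7, 8, 8}) (by decide) (by decide) (by decide)
      (by unfold IsHodgeMultiset mNormSum; decide) (by unfold IsHodgeMultiset mNormSum; decide)
      (pair_eq hC (a := 5) (p := {5, 7}) (by decide) (by decide))
      (hC.surface {1, 7, 8, 8} (by unfold IsHodgeMultiset mNormSum; decide) (by decide))))

/-- `[1^1 4^2 5^2 7^1 11^2]`, `m = 12`: a Hodge multiset (Shioda's `𝔅^6_12` for `α` and its unit multiples ⟺ Weil type `(3,3)` of the
μ_12-primitive Prym, Schoen Cor. 1.9).  Base ℙ¹, `m = 12`, (3,3); closes OPEN rows x24h6n09_g59, x24h6n22_g59.  [locator FERMAT-G31 §5]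
research route, not a corollary; conditional on HC_CM plus one named minimal statement. -/
theorem isHodgeMultiset_1_4_4_5_5_7_11_11 : IsHodgeMultiset ({1, 4, 4, 5, 5, 7, 11, 11} : Multiset (ZMod 12)) := by
  unfold IsHodgeMultiset mNormSum; decide

/-- `[1^1 4^2 5^2 7^1 11^2]`, `m = 12`: in every `IsShiodaClosed` family via `(pair[1, 11] + (pair[5, 7] + surface[4, 4, 5, 11]))` — with `C = 𝔈_12`:
the eigenlines `V(tα) ⊂ H^6(X^6_12; ℂ)` are algebraic granted Shioda 1979 Thm II c)/§4 Lemma 1 and Lefschetz (1,1) (no `(P_12)`).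
[locator FERMAT-G31 §2, §5]  research route, not a corollary; conditional on HC_CM plus one named minimal statement. -/
theorem mem_of_isShiodaClosed_1_4_4_5_5_7_11_11 {C : Multiset (ZMod 12) → Prop} (hC : IsShiodaClosed C) :
    C ({1, 4, 4, 5, 5, 7, 11, 11} : Multiset (ZMod 12)) :=
  (star_eq hC (t := {1, 11}) (u := {4, 4, 5, 5, 7, 11}) (by decide) (by decide) (by decide)
    (by unfold IsHodgeMultiset mNormSum; decide) (by unfold IsHodgeMultiset mNormSum; decide)
    (pair_eq hC (a := 1) (p := {1, 11}) (by decide) (by decide))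
    (star_eq hC (t := {5, 7}) (u := {4, 4, 5, 11}) (by decide) (by decide) (by decide)
      (by unfold IsHodgeMultiset mNormSum; decide) (by unfold IsHodgeMultiset mNormSum; decide)
      (pair_eq hC (a := 5) (p := {5, 7}) (by decide) (by decide))
      (hC.surface {4, 4, 5, 11} (by unfold IsHodgeMultiset mNormSum; decide) (by decide))))

end Summit.HodgeConjecture.Ring2AbelianAll.FermatQuotientCharactersSixfolds
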